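import Summits.Ventures.HodgeRepro2.B3Hilbert90
import Summits.Ventures.HodgeRepro2.B3Characters

/-!
# T5NormOneCharacters — characters of `E^×` trivial on `F^×` are `ν(a / ā)`

Tier-5 support for sub-step N2 (route/T5-N2-route-3.md §N2.10.2, the one-line [A]):
«our `U(V)`-side character `χ′_V` and `γ²` differ by `ν_E := χ′_V χ_V^{−2}`, a character of `E^×`
trivial on `F^×`, hence of the form `ν_E(a) = ν(a/ā)` for a character `ν` of `E¹` (Hilbert 90)».

Built on p2's landed files, nothing re-declared: `B3Characters.jHom c` (`x ↦ x · (c x)⁻¹` on a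
commutative group), `B3Characters.normOne c` (`{y : y · c y = 1}`), `B3Characters.mem_ker_jHom_iff`
(`ker j` = the `c`-fixed elements) and `B3Hilbert90.exists_div_conj_of_mul_conj_eq_one` (Hilbert 90
for an involution of a field, element form).  Added here, for the unit group `Lˣ` of a field `L`
with a ring involution `c` (the conjugation of `E_v / F_v`, `A := Lˣ`):

* `range_jHom_eq_normOne` : `range (jHom c) = normOne c` — Hilbert 90 in subgroup form (p2's
  `B3Characters` annex lists «the surjectivity of `j`» as what stayed prose);
* `jHomNormOne` : `Lˣ →* normOne c`, onto (`jHomNormOne_surjective`), kernel = fixed units;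
* `exists_factor_normOne` / `factor_unique` : every homomorphism `φ : Lˣ →* A` trivial on the fixed
  units `F^×` is `φ a = ν (a / c a)` for a UNIQUE `ν : normOne c →* A` — with no anticyclotomic or
  odd-order hypothesis (p2's `IsAnticyclotomic.descend` is the adelic special case on `range j`).

Read on `det`: HKS96 (a.43)–(a.44) `det g = x(g) / x̄(g)` turns a character `ν_E ∘ x` of `E^×` trivial
on `F^×` into `ν ∘ det`, the twist line of N2.10.2.  Everything is proved (0 sorries);
axioms ⊆ {propext, Classical.choice, Quot.sound}.
KEY-HYGIENE (README §8(d)): uses an L-value-free non-vanishing device: NO.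
-/

namespace Summit.Ventures.HodgeRepro2.T5NormOneCharacters

open Summit.Ventures.HodgeRepro2.ShimuraData.B3Hilbert90
open Summit.Ventures.HodgeRepro2.ShimuraData.B3Characters

variable {L : Type*} [Field L] (c : L ≃+* L)

/-- The ring involution `c` of `L` on the unit group `Lˣ`, as a group automorphism. -/
def unitsConj : Lˣ ≃* Lˣ := Units.mapEquiv c.toMulEquiv

/-- `(unitsConj c a : L) = c a`. -/
@[simp]
theorem coe_unitsConj (a : Lˣ) : ((unitsConj c a : Lˣ) : L) = c a := rfl

/-- `unitsConj` is an involution when `c` is. -/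
theorem unitsConj_unitsConj (hc : ∀ x, c (c x) = x) (a : Lˣ) :
    unitsConj c (unitsConj c a) = a := by
  apply Units.ext
  simp [hc]

/-- `(jHom (unitsConj c) a : L) = a / c a`. -/
@[simp]
theorem coe_jHom (a : Lˣ) : ((jHom (unitsConj c) a : Lˣ) : L) = (a : L) / c a := by
  rw [jHom_apply, Units.val_mul, Units.val_inv_eq_inv_val, coe_unitsConj, div_eq_mul_inv]

/-- The kernel of `a ↦ a / c a` is the group of fixed units (`F^×`), read on `L`. -/
theorem mem_ker_jHom_iff_conj_eq (a : Lˣ) : a ∈ (jHom (unitsConj c)).ker ↔ c a = a := by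
  rw [mem_ker_jHom_iff]
  constructor
  · intro h; exact congrArg Units.val h
  · intro h; exact Units.ext h

/-- Membership in `normOne (unitsConj c)`, read on `L`. -/
theorem mem_normOne_iff_coe (y : Lˣ) : y ∈ normOne (unitsConj c) ↔ (y : L) * c y = 1 := by
  rw [mem_normOne_iff]
  constructor
  · intro h; simpa using congrArg Units.val h
  · intro h; exact Units.ext (by simpa using h)

/-- **Hilbert 90 in subgroup form**: the range of `a ↦ a / c a` on `Lˣ` is exactly the norm-one
group `{y : y · c y = 1}` (the `⊇` half is p2's `exists_div_conj_of_mul_conj_eq_one`). -/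
theorem range_jHom_eq_normOne (hc : ∀ x, c (c x) = x) (hne : ∃ a, c a ≠ a) :
    (jHom (unitsConj c)).range = normOne (unitsConj c) := by
  apply le_antisymm
  · rintro _ ⟨a, rfl⟩
    exact jHom_mem_normOne (unitsConj c) (unitsConj_unitsConj c hc) a
  · intro y hy
    rw [mem_normOne_iff_coe] at hy
    obtain ⟨e, he, hye⟩ := exists_div_conj_of_mul_conj_eq_one c hc hne hy
    refine ⟨Units.mk0 e he, Units.ext ?_⟩
    rw [coe_jHom, Units.val_mk0, hye]

/-- `a ↦ a / c a`, corestricted to the norm-one group. -/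
def jHomNormOne (hc : ∀ x, c (c x) = x) : Lˣ →* normOne (unitsConj c) :=
  (jHom (unitsConj c)).codRestrict _ (jHom_mem_normOne (unitsConj c) (unitsConj_unitsConj c hc))

/-- `(jHomNormOne c hc a : L) = a / c a`. -/
@[simp]
theorem coe_jHomNormOne (hc : ∀ x, c (c x) = x) (a : Lˣ) :
    ((jHomNormOne c hc a : Lˣ) : L) = (a : L) / c a :=
  coe_jHom c a

/-- `jHomNormOne` is onto (Hilbert 90). -/
theorem jHomNormOne_surjective (hc : ∀ x, c (c x) = x) (hne : ∃ a, c a ≠ a) :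
    Function.Surjective (jHomNormOne c hc) := by
  intro y
  have hy : (y : Lˣ) ∈ (jHom (unitsConj c)).range := by
    rw [range_jHom_eq_normOne c hc hne]; exact y.2
  obtain ⟨a, ha⟩ := hy
  exact ⟨a, Subtype.ext ha⟩

/-- The kernel of the corestriction is still the fixed units. -/
theorem mem_ker_jHomNormOne_iff (hc : ∀ x, c (c x) = x) (a : Lˣ) :
    a ∈ (jHomNormOne c hc).ker ↔ c a = a := by
  rw [← mem_ker_jHom_iff_conj_eq, MonoidHom.mem_ker, MonoidHom.mem_ker]
  constructor
  · intro h; exact congrArg Subtype.val h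
  · intro h; exact Subtype.ext h

/-- **Characters of `E^×` trivial on `F^×` are `ν(a / ā)`.** Every homomorphism `φ : Lˣ →* A`
trivial on the fixed units factors through the norm-one group: `φ a = ν (a / c a)`. -/
theorem exists_factor_normOne {A : Type*} [Group A] (hc : ∀ x, c (c x) = x) (hne : ∃ a, c a ≠ a)
    (φ : Lˣ →* A) (hφ : ∀ a : Lˣ, c a = a → φ a = 1) :
    ∃ ν : normOne (unitsConj c) →* A, ∀ a : Lˣ, φ a = ν (jHomNormOne c hc a) := by
  have hker : (jHomNormOne c hc).ker ≤ φ.ker := by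
    intro a ha
    rw [mem_ker_jHomNormOne_iff] at ha
    exact MonoidHom.mem_ker.mpr (hφ a ha)
  refine ⟨(jHomNormOne c hc).liftOfSurjective (jHomNormOne_surjective c hc hne) ⟨φ, hker⟩,
    fun a => ?_⟩
  exact ((jHomNormOne c hc).liftOfRightInverse_comp_apply _ _ ⟨φ, hker⟩ a).symm

/-- The factor `ν` is unique (the norm-one group is the full image). -/
theorem factor_unique {A : Type*} [Group A] (hc : ∀ x, c (c x) = x) (hne : ∃ a, c a ≠ a)
    (ν₁ ν₂ : normOne (unitsConj c) →* A)
    (h : ∀ a : Lˣ, ν₁ (jHomNormOne c hc a) = ν₂ (jHomNormOne c hc a)) : ν₁ = ν₂ := by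
  ext y
  obtain ⟨a, rfl⟩ := jHomNormOne_surjective c hc hne y
  exact h a

/-- Conversely every `ν ∘ (a ↦ a / c a)` is trivial on the fixed units. -/
theorem comp_jHomNormOne_fixed {A : Type*} [Group A] (hc : ∀ x, c (c x) = x)
    (ν : normOne (unitsConj c) →* A) (a : Lˣ) (ha : c a = a) : ν (jHomNormOne c hc a) = 1 := by
  rw [MonoidHom.mem_ker.mp ((mem_ker_jHomNormOne_iff c hc a).mpr ha), map_one]

end Summit.Ventures.HodgeRepro2.T5NormOneCharacters
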